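import Mathlib
import Summits.NavierStokesRegularity.NavierStokesRegularity.Theorems.EulerZoomLiouvillePowerGaugeEulerLiouvilleHoopCircleModes

/-!
# H-MODES (2/3): THE CIRCLE INEQUALITY of the hoop lever (K-HOOP split (b); HOOP-NOTE dc156936fff7 §4, modes `m = ±1`)

Width piece for crux `EulerZoomLiouville.PowerGaugeEulerLiouville` (stmt-NavierStokesRegularity-19832); seat ns-ezl-w2 g5,
`--supports stmt-NavierStokesRegularity-19832 --as helper`.

* **`hoop_circle_le`**: for `a, b : ℝ → ℝ` with continuous derivatives `a′, b′` and `a(2π) = a(0)`, `b(2π) = b(0)`: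
  `∫₀^{2π} (a² − b²) ≤ ∫₀^{2π} [(a′ − b)² + (b′ + a)²] + 2∫₀^{2π} (P₁a)·(b′ + a)`,
  `P₁a = π⁻¹(∫a cos) cos + π⁻¹(∫a sin) sin` (written out).  Proof: with `a = a₁ + p`, `b = b₁ + q` (`a₁ = P₁a`, `b₁ = P₁b`), the
  difference `RHS − LHS = 3∫(a₁ + b₁′)² + [∫p′² + ∫q′² + 2∫q² + 4∫pq′]` after one integration by parts (`∫a′b = −∫ab′`), the
  first-mode evaluations of `…HoopCircleModes`, and `sharp_modes_nonneg` for the bracket (HOOP-NOTE §4: modes `±1` give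
  `∫(a₁² − b₁²) = 2∫a₁d₁′ − ∫d₁²`, `d₁ = b₁ − a₁′`; modes `≠ ±1` are the bracket).
In the hoop assembly `a = V_r`, `b = V_θ` on a circle of radius `t` about the axis, `(a′ − b)² + (b′ + a)² = t²(⟪DVê_θ, ê_r⟫² + ⟪DVê_θ, ê_θ⟫²)`
(θ̂-column, ns-ezl-w3 g6's H-FRAME) and `b′ + a = −t(∂_tV_r + ∂_zV_z)` (`div V = 0`), whence the axis atom and the end-disc fluxes.

HONEST FRAMING: a 1-D inequality; proves nothing about the crux E (19832 OPEN), the hoop inequality as a whole, or Navier–Stokes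
regularity. [folklore; HOOP-NOTE §4]
-/

noncomputable section

open Set Filter Topology Metric Function MeasureTheory Real
open scoped Interval

set_option linter.dupNamespace false

namespace Summit.NavierStokesRegularity.NavierStokesRegularity.Theorems.PowerGaugeEulerLiouville.HoopCore

/-- **THE CIRCLE INEQUALITY OF THE HOOP LEVER** (all azimuthal modes at once).  See the module docstring. [folklore; HOOP-NOTE §4] -/
theorem hoop_circle_le {a a' b b' : ℝ → ℝ} (ha : ∀ x, HasDerivAt a (a' x) x) (ha' : Continuous a')
    (haper : a (2 * π) = a 0) (hb : ∀ x, HasDerivAt b (b' x) x) (hb' : Continuous b') (hbper : b (2 * π) = b 0) :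
    ∫ x in (0 : ℝ)..2 * π, (a x ^ 2 - b x ^ 2) ≤
      (∫ x in (0 : ℝ)..2 * π, ((a' x - b x) ^ 2 + (b' x + a x) ^ 2)) +
        2 * ∫ x in (0 : ℝ)..2 * π,
          (π⁻¹ * (∫ y in (0 : ℝ)..2 * π, a y * Real.cos y) * Real.cos x +
            π⁻¹ * (∫ y in (0 : ℝ)..2 * π, a y * Real.sin y) * Real.sin x) * (b' x + a x) := by
  have hac : Continuous a := continuous_iff_continuousAt.2 fun x => (ha x).continuousAt
  have hbc : Continuous b := continuous_iff_continuousAt.2 fun x => (hb x).continuousAt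
  have hπ : (π : ℝ) ≠ 0 := Real.pi_ne_zero
  have hπ0 : 0 < π := Real.pi_pos
  -- the four first-mode coefficients
  set Ca := ∫ y in (0 : ℝ)..2 * π, a y * Real.cos y with hCa
  set Sa := ∫ y in (0 : ℝ)..2 * π, a y * Real.sin y with hSa
  set Cb := ∫ y in (0 : ℝ)..2 * π, b y * Real.cos y with hCb
  set Sb := ∫ y in (0 : ℝ)..2 * π, b y * Real.sin y with hSb
  obtain ⟨hCa', hSa'⟩ := firstMode_coeffs_deriv ha ha' haper
  obtain ⟨hCb', hSb'⟩ := firstMode_coeffs_deriv hb hb' hbper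
  -- the first-mode parts and the remainders
  set a₁ : ℝ → ℝ := fun x => π⁻¹ * Ca * Real.cos x + π⁻¹ * Sa * Real.sin x with ha₁
  set a₁d : ℝ → ℝ := fun x => π⁻¹ * Sa * Real.cos x + π⁻¹ * (-Ca) * Real.sin x with ha₁d
  set b₁ : ℝ → ℝ := fun x => π⁻¹ * Cb * Real.cos x + π⁻¹ * Sb * Real.sin x with hb₁
  set b₁d : ℝ → ℝ := fun x => π⁻¹ * Sb * Real.cos x + π⁻¹ * (-Cb) * Real.sin x with hb₁d
  have hfm_deriv : ∀ C S : ℝ, ∀ x, HasDerivAt (fun x => π⁻¹ * C * Real.cos x + π⁻¹ * S * Real.sin x)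
      (π⁻¹ * S * Real.cos x + π⁻¹ * (-C) * Real.sin x) x := by
    intro C S x
    have h := ((Real.hasDerivAt_cos x).const_mul (π⁻¹ * C)).add ((Real.hasDerivAt_sin x).const_mul (π⁻¹ * S))
    refine h.congr_deriv ?_
    ring
  have ha₁D : ∀ x, HasDerivAt a₁ (a₁d x) x := fun x => hfm_deriv Ca Sa x
  have hb₁D : ∀ x, HasDerivAt b₁ (b₁d x) x := fun x => hfm_deriv Cb Sb x
  set p : ℝ → ℝ := fun x => a x - a₁ x with hp
  set p' : ℝ → ℝ := fun x => a' x - a₁d x with hp'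
  set q : ℝ → ℝ := fun x => b x - b₁ x with hq
  set q' : ℝ → ℝ := fun x => b' x - b₁d x with hq'
  have hpD : ∀ x, HasDerivAt p (p' x) x := fun x => (ha x).sub (ha₁D x)
  have hqD : ∀ x, HasDerivAt q (q' x) x := fun x => (hb x).sub (hb₁D x)
  have hp'c : Continuous p' := by rw [hp', ha₁d]; fun_prop
  have hq'c : Continuous q' := by rw [hq', hb₁d]; fun_prop
  have hpper : p (2 * π) = p 0 := by simp [hp, ha₁, haper]
  have hqper : q (2 * π) = q 0 := by simp [hq, hb₁, hbper]
  -- `p` has no first modes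
  have hCp : ∫ x in (0 : ℝ)..2 * π, p x * Real.cos x = 0 := by
    have h := integral_firstMode_mul_sub_proj hac 1 0
    rw [← hCa, ← hSa] at h
    calc ∫ x in (0 : ℝ)..2 * π, p x * Real.cos x
        = ∫ x in (0 : ℝ)..2 * π, (1 * Real.cos x + 0 * Real.sin x) *
            (a x - (π⁻¹ * Ca * Real.cos x + π⁻¹ * Sa * Real.sin x)) :=
          intervalIntegral.integral_congr fun x _ => by rw [hp, ha₁]; ring
      _ = 0 := h
  have hSp : ∫ x in (0 : ℝ)..2 * π, p x * Real.sin x = 0 := by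
    have h := integral_firstMode_mul_sub_proj hac 0 1
    rw [← hCa, ← hSa] at h
    calc ∫ x in (0 : ℝ)..2 * π, p x * Real.sin x
        = ∫ x in (0 : ℝ)..2 * π, (0 * Real.cos x + 1 * Real.sin x) *
            (a x - (π⁻¹ * Ca * Real.cos x + π⁻¹ * Sa * Real.sin x)) :=
          intervalIntegral.integral_congr fun x _ => by rw [hp, ha₁]; ring
      _ = 0 := h
  -- the modes `≠ ±1`
  have hF3 := sharp_modes_nonneg hpD hp'c hpper hqD hq'c hqper hCp hSp
  -- first-mode evaluations
  have e1 : ∫ x in (0 : ℝ)..2 * π, a₁d x * a' x = π⁻¹ * Sa * Sa + π⁻¹ * (-Ca) * (-Ca) := by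
    rw [ha₁d, integral_firstMode_mul ha', hCa', hSa']
  have e2 : ∫ x in (0 : ℝ)..2 * π, a₁d x ^ 2 = π * ((π⁻¹ * Sa) ^ 2 + (π⁻¹ * (-Ca)) ^ 2) := by
    rw [ha₁d, integral_firstMode_sq]
  have e3 : ∫ x in (0 : ℝ)..2 * π, b₁d x * b' x = π⁻¹ * Sb * Sb + π⁻¹ * (-Cb) * (-Cb) := by
    rw [hb₁d, integral_firstMode_mul hb', hCb', hSb']
  have e4 : ∫ x in (0 : ℝ)..2 * π, b₁d x ^ 2 = π * ((π⁻¹ * Sb) ^ 2 + (π⁻¹ * (-Cb)) ^ 2) := by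
    rw [hb₁d, integral_firstMode_sq]
  have e5 : ∫ x in (0 : ℝ)..2 * π, b₁ x * b x = π⁻¹ * Cb * Cb + π⁻¹ * Sb * Sb := by
    rw [hb₁, integral_firstMode_mul hbc]
  have e6 : ∫ x in (0 : ℝ)..2 * π, b₁ x ^ 2 = π * ((π⁻¹ * Cb) ^ 2 + (π⁻¹ * Sb) ^ 2) := by
    rw [hb₁, integral_firstMode_sq]
  have e7 : ∫ x in (0 : ℝ)..2 * π, b₁d x * a x = π⁻¹ * Sb * Ca + π⁻¹ * (-Cb) * Sa := by
    rw [hb₁d, integral_firstMode_mul hac]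
  have e8 : ∫ x in (0 : ℝ)..2 * π, a₁ x * b' x = π⁻¹ * Ca * Sb + π⁻¹ * Sa * (-Cb) := by
    rw [ha₁, integral_firstMode_mul hb', hCb', hSb']
  have e9 : ∫ x in (0 : ℝ)..2 * π, a₁ x * b₁d x = π * (π⁻¹ * Ca * (π⁻¹ * Sb) + π⁻¹ * Sa * (π⁻¹ * (-Cb))) := by
    rw [ha₁, hb₁d, integral_firstMode_mul_firstMode]
  have e10 : ∫ x in (0 : ℝ)..2 * π, a₁ x * a x = π⁻¹ * Ca * Ca + π⁻¹ * Sa * Sa := by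
    rw [ha₁, integral_firstMode_mul hac]
  -- integrability of the atoms
  have ia1 : IntervalIntegrable a₁ volume 0 (2 * π) := by rw [ha₁]; exact (by fun_prop : Continuous _).intervalIntegrable _ _
  have ia1d : IntervalIntegrable a₁d volume 0 (2 * π) := by
    rw [ha₁d]; exact (by fun_prop : Continuous _).intervalIntegrable _ _
  have hc_a₁ : Continuous a₁ := by rw [ha₁]; fun_prop
  have hc_a₁d : Continuous a₁d := by rw [ha₁d]; fun_prop
  have hc_b₁ : Continuous b₁ := by rw [hb₁]; fun_prop
  have hc_b₁d : Continuous b₁d := by rw [hb₁d]; fun_prop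
  -- expansions of the four integrals of `sharp_modes_nonneg`
  have x1 : ∫ x in (0 : ℝ)..2 * π, p' x ^ 2 =
      (∫ x in (0 : ℝ)..2 * π, a' x ^ 2) - 2 * (∫ x in (0 : ℝ)..2 * π, a₁d x * a' x) + ∫ x in (0 : ℝ)..2 * π, a₁d x ^ 2 := by
    have e : (fun x => p' x ^ 2) = fun x => a' x ^ 2 - 2 * (a₁d x * a' x) + a₁d x ^ 2 := funext fun x => by
      simp only [hp']; ring
    rw [e, intervalIntegral.integral_add, intervalIntegral.integral_sub, intervalIntegral.integral_const_mul]
    · exact (ha'.pow 2).intervalIntegrable _ _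
    · exact ((hc_a₁d.mul ha').const_mul 2).intervalIntegrable _ _
    · exact ((ha'.pow 2).sub ((hc_a₁d.mul ha').const_mul 2)).intervalIntegrable _ _
    · exact (hc_a₁d.pow 2).intervalIntegrable _ _
  have x2 : ∫ x in (0 : ℝ)..2 * π, q' x ^ 2 =
      (∫ x in (0 : ℝ)..2 * π, b' x ^ 2) - 2 * (∫ x in (0 : ℝ)..2 * π, b₁d x * b' x) + ∫ x in (0 : ℝ)..2 * π, b₁d x ^ 2 := by
    have e : (fun x => q' x ^ 2) = fun x => b' x ^ 2 - 2 * (b₁d x * b' x) + b₁d x ^ 2 := funext fun x => by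
      simp only [hq']; ring
    rw [e, intervalIntegral.integral_add, intervalIntegral.integral_sub, intervalIntegral.integral_const_mul]
    · exact (hb'.pow 2).intervalIntegrable _ _
    · exact ((hc_b₁d.mul hb').const_mul 2).intervalIntegrable _ _
    · exact ((hb'.pow 2).sub ((hc_b₁d.mul hb').const_mul 2)).intervalIntegrable _ _
    · exact (hc_b₁d.pow 2).intervalIntegrable _ _
  have x3 : ∫ x in (0 : ℝ)..2 * π, q x ^ 2 =
      (∫ x in (0 : ℝ)..2 * π, b x ^ 2) - 2 * (∫ x in (0 : ℝ)..2 * π, b₁ x * b x) + ∫ x in (0 : ℝ)..2 * π, b₁ x ^ 2 := by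
    have e : (fun x => q x ^ 2) = fun x => b x ^ 2 - 2 * (b₁ x * b x) + b₁ x ^ 2 := funext fun x => by
      simp only [hq]; ring
    rw [e, intervalIntegral.integral_add, intervalIntegral.integral_sub, intervalIntegral.integral_const_mul]
    · exact (hbc.pow 2).intervalIntegrable _ _
    · exact ((hc_b₁.mul hbc).const_mul 2).intervalIntegrable _ _
    · exact ((hbc.pow 2).sub ((hc_b₁.mul hbc).const_mul 2)).intervalIntegrable _ _
    · exact (hc_b₁.pow 2).intervalIntegrable _ _
  have x4 : ∫ x in (0 : ℝ)..2 * π, p x * q' x =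
      (∫ x in (0 : ℝ)..2 * π, a x * b' x) - (∫ x in (0 : ℝ)..2 * π, b₁d x * a x) -
        (∫ x in (0 : ℝ)..2 * π, a₁ x * b' x) + ∫ x in (0 : ℝ)..2 * π, a₁ x * b₁d x := by
    have e : (fun x => p x * q' x) = fun x => a x * b' x - b₁d x * a x - a₁ x * b' x + a₁ x * b₁d x :=
      funext fun x => by simp only [hp, hq']; ring
    rw [e, intervalIntegral.integral_add, intervalIntegral.integral_sub, intervalIntegral.integral_sub]
    · exact (hac.mul hb').intervalIntegrable _ _
    · exact (hc_b₁d.mul hac).intervalIntegrable _ _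
    · exact ((hac.mul hb').sub (hc_b₁d.mul hac)).intervalIntegrable _ _
    · exact (hc_a₁.mul hb').intervalIntegrable _ _
    · exact (((hac.mul hb').sub (hc_b₁d.mul hac)).sub (hc_a₁.mul hb')).intervalIntegrable _ _
    · exact (hc_a₁.mul hc_b₁d).intervalIntegrable _ _
  -- expansions of the two integrals of the statement
  have hIBP : ∫ x in (0 : ℝ)..2 * π, a' x * b x = -∫ x in (0 : ℝ)..2 * π, a x * b' x := by
    have h := intervalIntegral.integral_mul_deriv_eq_deriv_mul (a := 0) (b := 2 * π) (u := a) (v := b)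
      (u' := a') (v' := b') (fun x _ => ha x) (fun x _ => hb x) (ha'.intervalIntegrable _ _) (hb'.intervalIntegrable _ _)
    rw [haper, hbper, sub_self, zero_sub] at h
    rw [h, neg_neg]
  have y1 : ∫ x in (0 : ℝ)..2 * π, ((a' x - b x) ^ 2 + (b' x + a x) ^ 2) =
      (∫ x in (0 : ℝ)..2 * π, a' x ^ 2) + (∫ x in (0 : ℝ)..2 * π, b' x ^ 2) + (∫ x in (0 : ℝ)..2 * π, a x ^ 2) +
        (∫ x in (0 : ℝ)..2 * π, b x ^ 2) - 2 * (∫ x in (0 : ℝ)..2 * π, a' x * b x) +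
        2 * ∫ x in (0 : ℝ)..2 * π, a x * b' x := by
    have e : (fun x => (a' x - b x) ^ 2 + (b' x + a x) ^ 2) =
        fun x => a' x ^ 2 + b' x ^ 2 + a x ^ 2 + b x ^ 2 - 2 * (a' x * b x) + 2 * (a x * b' x) := funext fun x => by ring
    have i1 : IntervalIntegrable (fun x => a' x ^ 2) volume 0 (2 * π) := (ha'.pow 2).intervalIntegrable _ _
    have i2 : IntervalIntegrable (fun x => b' x ^ 2) volume 0 (2 * π) := (hb'.pow 2).intervalIntegrable _ _
    have i3 : IntervalIntegrable (fun x => a x ^ 2) volume 0 (2 * π) := (hac.pow 2).intervalIntegrable _ _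
    have i4 : IntervalIntegrable (fun x => b x ^ 2) volume 0 (2 * π) := (hbc.pow 2).intervalIntegrable _ _
    have i5 : IntervalIntegrable (fun x => 2 * (a' x * b x)) volume 0 (2 * π) :=
      ((ha'.mul hbc).const_mul 2).intervalIntegrable _ _
    have i6 : IntervalIntegrable (fun x => 2 * (a x * b' x)) volume 0 (2 * π) :=
      ((hac.mul hb').const_mul 2).intervalIntegrable _ _
    rw [e, intervalIntegral.integral_add ((((i1.add i2).add i3).add i4).sub i5) i6,
      intervalIntegral.integral_sub (((i1.add i2).add i3).add i4) i5,
      intervalIntegral.integral_add ((i1.add i2).add i3) i4, intervalIntegral.integral_add (i1.add i2) i3,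
      intervalIntegral.integral_add i1 i2, intervalIntegral.integral_const_mul, intervalIntegral.integral_const_mul]
  have y2 : ∫ x in (0 : ℝ)..2 * π, (π⁻¹ * Ca * Real.cos x + π⁻¹ * Sa * Real.sin x) * (b' x + a x) =
      (∫ x in (0 : ℝ)..2 * π, a₁ x * b' x) + ∫ x in (0 : ℝ)..2 * π, a₁ x * a x := by
    have i1 : IntervalIntegrable (fun x => a₁ x * b' x) volume 0 (2 * π) := (hc_a₁.mul hb').intervalIntegrable _ _
    have i2 : IntervalIntegrable (fun x => a₁ x * a x) volume 0 (2 * π) := (hc_a₁.mul hac).intervalIntegrable _ _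
    rw [← intervalIntegral.integral_add i1 i2]
    exact intervalIntegral.integral_congr fun x _ => by rw [ha₁]; ring
  -- the statement's left side
  have y0 : ∫ x in (0 : ℝ)..2 * π, (a x ^ 2 - b x ^ 2) =
      (∫ x in (0 : ℝ)..2 * π, a x ^ 2) - ∫ x in (0 : ℝ)..2 * π, b x ^ 2 :=
    intervalIntegral.integral_sub ((hac.pow 2).intervalIntegrable _ _) ((hbc.pow 2).intervalIntegrable _ _)
  -- simplify the first-mode scalars
  have key : π * ((π⁻¹ * Sa) ^ 2 + (π⁻¹ * (-Ca)) ^ 2) = π⁻¹ * (Sa ^ 2 + Ca ^ 2) := by field_simp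
  have key2 : π * ((π⁻¹ * Sb) ^ 2 + (π⁻¹ * (-Cb)) ^ 2) = π⁻¹ * (Sb ^ 2 + Cb ^ 2) := by field_simp
  have key3 : π * ((π⁻¹ * Cb) ^ 2 + (π⁻¹ * Sb) ^ 2) = π⁻¹ * (Cb ^ 2 + Sb ^ 2) := by field_simp
  have key4 : π * (π⁻¹ * Ca * (π⁻¹ * Sb) + π⁻¹ * Sa * (π⁻¹ * (-Cb))) = π⁻¹ * (Ca * Sb - Sa * Cb) := by
    field_simp; ring
  rw [key] at e2
  rw [key2] at e4
  rw [key3] at e6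
  rw [key4] at e9
  rw [x1, x2, x3, x4, e1, e2, e3, e4, e5, e6, e7, e8, e9] at hF3
  rw [y0, y1, y2, hIBP, e8, e10]
  -- nonnegative terms and the final count
  set ip := π⁻¹ with hip
  have hip0 : 0 ≤ ip := inv_nonneg.2 hπ0.le
  have hsq : 0 ≤ ip * ((Ca + Sb) ^ 2 + (Sa - Cb) ^ 2) := by positivity
  linear_combination hF3 + 3 * hsq

end Summit.NavierStokesRegularity.NavierStokesRegularity.Theorems.PowerGaugeEulerLiouville.HoopCore

end
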